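import Literature.MathematicalPhysics.QuantumFieldTheory.Balaban1983to89.HiggsLattice

/-!
# `Balaban1983to89.B3VertexTensorBounds` — T. Bałaban, *(Higgs)₂,₃ quantum fields in a finite volume. III. Renormalization*,
# Commun. Math. Phys. **88** (1983) 411–445 [Balaban1983Higgs3], p. 426: «Finally in vertices we apply the inequalities
# |q| ≦ 1, |R_{n̄+1}(·)| ≦ 1» — the two VERTEX TENSOR BOUNDS of the first estimate, PROVED for the tree's charge datum
# `HiggsLattice.ChargeData` of [Balaban1982Higgs1] (1.7) and the operator-valued Taylor remainder `R_{n̄+1}` of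
# [Balaban1982Higgs1] (3.14) / [Balaban1983Higgs3] (1.15)

statement-level skeleton of published theorems with citation tags; proofs where landed; nothing here is a claim about the Yang–Mills mass gap

PDF held: `paper:balaban1983-higgs-2-3-quantum-fields-finite-volume` (journal page = PDF page + 410); p. 426 [PDF 16] read on the
render `run/shared/lean/pub/pub-balaban/b2b-balaban-ref1/pages/1983-cmp88-higgs23-III/1983-cmp88-higgs23-III-p016-x2.png` (the OCR
text `p0016.txt` garbles the sentence), p. 414 [PDF 4] on `…-p004-x2.png`; [B1] = T. Bałaban, *(Higgs)₂,₃ quantum fields in a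
finite volume. I*, CMP **85** (1982) 603–636 [Balaban1982Higgs1], (1.7) p. 605, (3.14) p. 614, p. 615.

CITATION HEADER (lean-in-tree rule).  Part of the lit-balaban TYPED SKELETON (HOME `run/shared/lean/pub/lit-balaban/`), Phase 2:
SKELETON row **B3.Eq2.12** (`HOME/lit-balaban-r15/ROWS-B3.md`, fold owner r15 = this seat), whose informal cell carries, after
the display (2.12), print's sentence *"Finally in vertices we apply the inequalities |q| ≦ 1, |R_{n̄+1}(·)| ≦ 1"* (p. 426 L22);
the cell lead's head word on the row (HOME/STATUS 2026-08-22T21:48:26Z) asks for a member proving both bounds for the tree's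
objects — this file.  Reader/typer seat `lit-balaban-r15` gen 13.  THEOREMS plus one definition with a body (`taylorRemOp`, the
printed remainder `R_{n̄+1}`); no `def … : Prop` fact is introduced; no existing declaration is modified; imports the typer's
`HiggsLattice` only.

## What is printed

[Balaban1983Higgs3] p. 426 [PDF 16]: *"In the next step we make a first estimate of the expression. We estimate it taking
absolute values of all factors. … Finally in vertices we apply the inequalities |q| ≦ 1, |R_{n̄+1}(·)| ≦ 1."*  The vertices are
(1.6)–(1.15) pp. 413–414; the tensors `q` and `R_{n̄+1}` enter through (1.8)–(1.11) and (1.14)–(1.15), e.g. (1.15) p. 414: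
*"−(e(L^kε))^{n+n̄+1}(1/(n!(n̄+1)!)) Σ_{x∈B^k(y)} η^d (A′(Γ^{(k)}_{y,x}))^n (Ã(Γ^{(k)}_{y,x}))^{n̄+1} · q^{n+n̄+1}
R_{n̄+1}(qe(L^kε)Ã(Γ^{(k)}_{y,x})) U(B̃(Γ^{(k)}_{y,x}))φ′(x), n ≦ n̄"*, and p. 414: *"Finally let us recall that R_{n̄+1}(qA) is
an analytic function of A ∈ R with values in linear operators on R^N satisfying the inequality |R_{n̄+1}(qA)| ≦ 1."*
[Balaban1982Higgs1] (1.7) p. 605: *"U(A) = exp(qεeA), A ∈ R, where e is a coupling constant and q is an antisymmetric N × N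
matrix. We will assume only that ‖q‖ ≦ 1."*; (3.14) p. 614: *"R_{n̄+1}(z) is an analytic function of z defined by the formula
R_{n̄+1}(z) = (n̄+1)∫₀¹(1−t)^{n̄}e^{tz}dt"* and *"U(A) = exp(ηqe(L^kε)A) = 1 + Σ_{n=1}^{n̄}(ηqe(L^kε)A)ⁿ/n! +
(ηqe(L^kε)A)^{n̄+1}/(n̄+1)! R_{n̄+1}(ηqe(L^kε)A)"*; p. 615: *"we can estimate the terms containing the matrix R_{n̄+1}(·)
using the inequality |R_{n̄+1}(qA)| ≦ 1, which holds for arbitrary real A"*.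

## What this file proves

* §1 **`|q| ≦ 1`** for the charge datum `C : HiggsLattice.ChargeData N` (operators on `ℝ^N = EuclideanSpace ℝ (Fin N)`): the
  bound itself is print's standing ASSUMPTION, the field `C.norm_q_le` (restated by name as `norm_q_le_one`); consequences
  used at the vertices (the pointwise `‖qv‖ ≦ ‖v‖` is p39's `B3WT226Pairings.norm_q_apply_le`, not restated): **`norm_q_pow_le_one`** (`‖q^m‖ ≦ 1`, the powers `q^{n+n′}`,
  `q^{n+n̄+1}` of (1.14)/(1.15)), `exp_smul_q_mem_unitary` / `norm_exp_smul_q_apply` / **`norm_exp_smul_q_le_one`**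
  (`exp(rq)` is unitary, an isometry, of norm `≦ 1` — `q* = −q`), **`norm_U_le_one`** (the transports `U(B̃(Γ))` of
  (1.13)–(1.15), `‖U‖ ≦ 1`).
* §2 the remainder of (I.3.14) in ANY complete normed real algebra `𝔸`: **`taylorRemOp n X := (n+1) • ∫₀¹ (1−t)ⁿ • exp(tX) dt`**
  (def with body, print's formula with `n = n̄`), the integration-by-parts recursion `taylorRem_step`, and **`exp_eq_taylor_sum_add`**:
  `exp X = Σ_{m=0}^{n} X^m/m! + (1/(n+1)!) • (taylorRemOp n X * X^{n+1})` — the operator form of (I.3.14) (Taylor's formula with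
  integral remainder, by induction with one integration by parts per step, as r12's scalar `B1Eq314Proof.eq314_holds`), with the
  commuted form `exp_eq_taylor_sum_add'` (`X^{n+1} * taylorRemOp n X`, print's order) via `commute_taylorRemOp`.
* §3 **`norm_taylorRemOp_le_one`**: if `‖exp(tX)‖ ≦ 1` for `t ∈ [0, 1]` then `‖R_{n+1}(X)‖ ≦ 1` (`‖∫‖ ≦ ∫₀¹(1−t)ⁿdt = 1/(n+1)`);
  hence for the charge datum **`norm_remOp_q_le_one`**: `‖R_{n̄+1}(s·q)‖ ≦ 1` for EVERY real `s` — print's *"|R_{n̄+1}(qA)| ≦ 1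
  … for arbitrary real A"* for the MATRIX-valued remainder (the scalar `N = 2` twin, `q = i`, is r12's
  `B1Sect3Statements.remBound_holds`), and `norm_qpow_mul_remOp_le_one` (the full tensor `q^{m}R_{n̄+1}(sq)` of (1.15) has norm `≦ 1`).

Honest scope: these are the two inequalities print APPLIES at p. 426 L22, for the tree's concrete (1.7) coupling; which vertex
carries which power of `q` / which remainder is the DATA of rows B3.Eq1.6-1.11 / B3.Eq1.12-1.15 (`B3Prop1.VertexKind`), and
the vertex estimate that consumes bounded tensors is p03 g5's `B3Ineq213Vertices.abs_u_le` (row B3.Eq2.13-2.14); nothing of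
(2.13) is re-proved here.
-/

namespace Literature.MathematicalPhysics.QuantumFieldTheory.Balaban1983to89.B3VertexTensorBounds

open _root_.MeasureTheory NormedSpace intervalIntegral
open scoped BigOperators InnerProductSpace
open Literature.MathematicalPhysics.QuantumFieldTheory.Balaban1983to89.HiggsLattice

noncomputable section

/-! ## §1. `|q| ≦ 1`: the charge matrix, its powers, the transports `U(A) = exp(qηeA)` -/

section Charge

variable {N : ℕ} (C : ChargeData N)

/-- **`|q| ≦ 1`** — print's standing assumption on the antisymmetric charge matrix ([Balaban1982Higgs1] p. 605 *"We will
assume only that ‖q‖ ≦ 1"*), the field `ChargeData.norm_q_le` of the tree's model datum, restated by name: this is the first of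
the two vertex inequalities applied at [Balaban1983Higgs3] p. 426. [cite: Balaban1983Higgs3, p.426 (vertex bounds after (2.12))]
[cite: Balaban1982Higgs1, (1.7) p.605] -/
theorem norm_q_le_one : ‖C.q‖ ≤ 1 := C.norm_q_le

/-- **`‖q^m‖ ≦ 1`** for every power — the tensors `q^{n+n′}` of (1.14) and `q^{n+n̄+1}` of (1.15) are bounded by `1`
(*"in vertices we apply the inequalities |q| ≦ 1"*). [cite: Balaban1983Higgs3, p.426 (vertex bounds after (2.12)), (1.14)–(1.15) pp.413–414] -/
theorem norm_q_pow_le_one (m : ℕ) : ‖C.q ^ m‖ ≤ 1 := by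
  induction m with
  | zero =>
      rw [pow_zero, ContinuousLinearMap.one_def]
      exact ContinuousLinearMap.norm_id_le
  | succ m ih =>
      rw [pow_succ]
      calc ‖C.q ^ m * C.q‖ ≤ ‖C.q ^ m‖ * ‖C.q‖ := norm_mul_le _ _
        _ ≤ 1 * 1 := mul_le_mul ih C.norm_q_le (norm_nonneg _) zero_le_one
        _ = 1 := one_mul _

/-- `exp(r q)` is unitary for every real `r` (antisymmetry `q* = −q`; [Balaban1982Higgs1] p. 605 *"a representation of the
additive group of real numbers R in unitary operators on R^N"*; cf. the typer's `ChargeData.U_mem_unitary`). [cite: Balaban1982Higgs1, (1.7) p.605] -/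
theorem exp_smul_q_mem_unitary (r : ℝ) :
    exp (r • C.q) ∈ unitary (EuclideanSpace ℝ (Fin N) →L[ℝ] EuclideanSpace ℝ (Fin N)) := by
  letI : NormedAlgebra ℚ (EuclideanSpace ℝ (Fin N) →L[ℝ] EuclideanSpace ℝ (Fin N)) :=
    NormedAlgebra.restrictScalars ℚ ℝ _
  exact exp_mem_unitary_of_mem_skewAdjoint (by
    rw [skewAdjoint.mem_iff, star_smul, C.q_skew, star_trivial, smul_neg])

/-- `exp(r q)` is an isometry of `ℝ^N`. [cite: Balaban1982Higgs1, (1.7) p.605] -/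
theorem norm_exp_smul_q_apply (r : ℝ) (v : EuclideanSpace ℝ (Fin N)) : ‖exp (r • C.q) v‖ = ‖v‖ :=
  ContinuousLinearMap.norm_map_of_mem_unitary (exp_smul_q_mem_unitary C r) v

/-- **`‖exp(r q)‖ ≦ 1`** (operator norm) for every real `r`. [cite: Balaban1982Higgs1, (1.7) p.605] -/
theorem norm_exp_smul_q_le_one (r : ℝ) : ‖exp (r • C.q)‖ ≤ 1 :=
  ContinuousLinearMap.opNorm_le_bound _ zero_le_one fun v => by
    rw [one_mul, norm_exp_smul_q_apply]

/-- **`‖U(A)‖ ≦ 1`** for the transports `U(A) = exp(qηeA)` of (1.7) — the factors `U(B̃(Γ^{(k)}_{y,x}))` of the vertices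
(1.13)–(1.15) are bounded by `1` when *"taking absolute values of all factors"* (p. 426). [cite: Balaban1983Higgs3, p.426 (vertex bounds after (2.12)), (1.13)–(1.15) pp.413–414]
[cite: Balaban1982Higgs1, (1.7) p.605] -/
theorem norm_U_le_one (η A : ℝ) : ‖C.U η A‖ ≤ 1 :=
  norm_exp_smul_q_le_one C (η * C.e * A)

end Charge

/-! ## §2. The remainder `R_{n̄+1}` of (I.3.14) in a complete normed real algebra and Taylor's formula for `exp` -/

section Remainder

variable {𝔸 : Type*} [NormedRing 𝔸] [NormedAlgebra ℝ 𝔸] [CompleteSpace 𝔸]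

/-- **The remainder `R_{n+1}(X) := (n+1)∫₀¹(1−t)ⁿ exp(tX) dt`** of [Balaban1982Higgs1] (3.14) (*"R_{n̄+1}(z) is an analytic
function of z defined by the formula R_{n̄+1}(z) = (n̄+1)∫₀¹(1−t)^{n̄}e^{tz}dt"*, here with `n = n̄`), for an element `X` of any
complete normed real algebra — in [Balaban1983Higgs3] (1.15) the argument is the matrix `X = qe(L^kε)Ã(Γ^{(k)}_{y,x})`
(*"an analytic function of A ∈ R with values in linear operators on R^N"*, p. 414). [cite: Balaban1982Higgs1, (3.14) p.614]
[cite: Balaban1983Higgs3, (1.15) p.414] -/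
def taylorRemOp (n : ℕ) (X : 𝔸) : 𝔸 :=
  ((n : ℝ) + 1) • ∫ t in (0:ℝ)..1, (1 - t) ^ n • exp (t • X)

/-- `t ↦ exp(tX)` is continuous (it is differentiable, Mathlib `hasDerivAt_exp_smul_const`). [folklore] -/
private theorem continuous_exp_smul (X : 𝔸) : Continuous fun t : ℝ => exp (t • X) :=
  continuous_iff_continuousAt.2 fun t => (hasDerivAt_exp_smul_const (𝕂 := ℝ) X t).continuousAt

/-- The kernels `(1−t)^m exp(tX)` are continuous, hence interval-integrable. [folklore] -/
private theorem intervalIntegrable_kernel (m : ℕ) (X : 𝔸) (a b : ℝ) :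
    IntervalIntegrable (fun t : ℝ => (1 - t) ^ m • exp (t • X)) volume a b :=
  (((continuous_const.sub continuous_id).pow m).smul (continuous_exp_smul X)).intervalIntegrable a b

omit [CompleteSpace 𝔸] in
/-- `X` commutes with `exp(tX)`. [folklore] -/
private theorem commute_exp_smul (X : 𝔸) (t : ℝ) : Commute X (exp (t • X)) :=
  ((Commute.refl X).smul_right t).exp_right

/-- FTC kernel for the base case: `d/dt exp(tX) = exp(tX)·X`. [folklore] -/
private theorem hasDerivAt_exp_line (X : 𝔸) (t : ℝ) :
    HasDerivAt (fun s : ℝ => exp (s • X)) (exp (t • X) * X) t :=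
  hasDerivAt_exp_smul_const (𝕂 := ℝ) X t

/-- Base case `n̄ + 1 = 1` of (I.3.14): `(∫₀¹ exp(tX) dt)·X = exp X − 1`, i.e. `exp X = 1 + R_1(X)·X` (FTC; no inverse of `X`
needed). [cite: Balaban1982Higgs1, (3.14) p.614] -/
theorem integral_exp_smul_mul (X : 𝔸) : (∫ t in (0:ℝ)..1, exp (t • X)) * X = exp X - 1 := by
  have hint : IntervalIntegrable (fun t : ℝ => exp (t • X) * X) volume 0 1 :=
    ((continuous_exp_smul X).mul continuous_const).intervalIntegrable 0 1
  have hftc := integral_eq_sub_of_hasDerivAt (fun t _ => hasDerivAt_exp_line X t) hint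
  have hcomm : (∫ t in (0:ℝ)..1, exp (t • X) * X) = (∫ t in (0:ℝ)..1, exp (t • X)) * X := by
    have h0 : IntervalIntegrable (fun t : ℝ => exp (t • X)) volume 0 1 := (continuous_exp_smul X).intervalIntegrable 0 1
    simpa using ((ContinuousLinearMap.mul ℝ 𝔸).flip X).intervalIntegral_comp_comm h0
  rw [← hcomm, hftc]
  simp

/-- FTC kernel for the induction step: `d/dt [−(1−t)^{n+1} exp(tX)] = (n+1)(1−t)ⁿ exp(tX) − (1−t)^{n+1} exp(tX)·X`.
[folklore] -/
private theorem hasDerivAt_kernel (n : ℕ) (X : 𝔸) (t : ℝ) :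
    HasDerivAt (fun s : ℝ => -((1 - s) ^ (n + 1) • exp (s • X)))
      (((n : ℝ) + 1) • ((1 - t) ^ n • exp (t • X)) - (1 - t) ^ (n + 1) • (exp (t • X) * X)) t := by
  have h1 : HasDerivAt (fun s : ℝ => (1 - s) ^ (n + 1)) (((n + 1 : ℕ) : ℝ) * (1 - t) ^ (n + 1 - 1) * (-1)) t :=
    ((hasDerivAt_id' t).const_sub 1).pow (n + 1)
  have h2 := hasDerivAt_exp_line X t
  have h3 := (h1.smul h2).neg
  refine h3.congr_deriv ?_
  simp only [Nat.add_sub_cancel, Nat.cast_add, Nat.cast_one]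
  module

/-- **Induction step of (I.3.14)**, the integration by parts `(n+1)∫₀¹(1−t)ⁿexp(tX)dt = 1 + (∫₀¹(1−t)^{n+1}exp(tX)dt)·X`, i.e.
`R_{n+1}(X) = 1 + R_{n+2}(X)·X/(n+2)`. [cite: Balaban1982Higgs1, (3.14) p.614] -/
theorem taylorRem_step (n : ℕ) (X : 𝔸) :
    taylorRemOp n X = 1 + (∫ t in (0:ℝ)..1, (1 - t) ^ (n + 1) • exp (t • X)) * X := by
  have hI : IntervalIntegrable (fun t : ℝ => ((n : ℝ) + 1) • ((1 - t) ^ n • exp (t • X))) volume 0 1 :=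
    (intervalIntegrable_kernel n X 0 1).smul ((n : ℝ) + 1)
  have hJ : IntervalIntegrable (fun t : ℝ => (1 - t) ^ (n + 1) • (exp (t • X) * X)) volume 0 1 :=
    (((continuous_const.sub continuous_id).pow (n + 1)).smul
      ((continuous_exp_smul X).mul continuous_const)).intervalIntegrable 0 1
  have hftc := integral_eq_sub_of_hasDerivAt (fun t _ => hasDerivAt_kernel n X t) (hI.sub hJ)
  rw [intervalIntegral.integral_sub hI hJ, intervalIntegral.integral_smul] at hftc
  have hcomm : (∫ t in (0:ℝ)..1, (1 - t) ^ (n + 1) • (exp (t • X) * X))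
      = (∫ t in (0:ℝ)..1, (1 - t) ^ (n + 1) • exp (t • X)) * X := by
    have h := ((ContinuousLinearMap.mul ℝ 𝔸).flip X).intervalIntegral_comp_comm
      (intervalIntegrable_kernel (n + 1) X 0 1)
    simpa [smul_mul_assoc] using h
  have hrhs : -((1 - 1 : ℝ) ^ (n + 1) • exp ((1:ℝ) • X)) - -((1 - 0 : ℝ) ^ (n + 1) • exp ((0:ℝ) • X)) = (1 : 𝔸) := by
    simp
  rw [hcomm, hrhs] at hftc
  unfold taylorRemOp
  exact eq_add_of_sub_eq hftc

/-- **(I.3.14) for operators, PROVED** — Taylor's formula with the integral remainder in a complete normed real algebra: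
`exp X = Σ_{m=0}^{n} X^m/m! + (1/(n+1)!)·R_{n+1}(X)·X^{n+1}` with `R_{n+1} = taylorRemOp n` (induction on `n`, one integration
by parts per step; the scalar complex case is r12's `B1Eq314Proof.eq314_holds`). [cite: Balaban1982Higgs1, (3.14) p.614] -/
theorem exp_eq_taylor_sum_add (n : ℕ) (X : 𝔸) :
    exp X = ∑ m ∈ Finset.range (n + 1), ((m.factorial : ℝ)⁻¹) • X ^ m
      + (((n + 1).factorial : ℝ)⁻¹) • (taylorRemOp n X * X ^ (n + 1)) := by
  induction n with
  | zero =>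
      have h0 := integral_exp_smul_mul X
      simp only [taylorRemOp, zero_add, Finset.range_one, Finset.sum_singleton, Nat.factorial_zero, Nat.factorial_one,
        Nat.cast_one, Nat.cast_zero, inv_one, pow_zero, pow_one, one_smul]
      rw [h0]; abel
  | succ n ih =>
      have hfac : ((((n + 1 + 1).factorial : ℕ) : ℝ))⁻¹ = ((((n + 1).factorial : ℕ) : ℝ))⁻¹ * ((n : ℝ) + 1 + 1)⁻¹ := by
        rw [Nat.factorial_succ (n + 1)]; push_cast; rw [mul_inv]; ring
      -- the (n+1)-st kernel integral in terms of the (n+1)-st remainder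
      have hR : (∫ t in (0:ℝ)..1, (1 - t) ^ (n + 1) • exp (t • X)) = ((n : ℝ) + 1 + 1)⁻¹ • taylorRemOp (n + 1) X := by
        unfold taylorRemOp
        rw [smul_smul]
        have : ((n : ℝ) + 1 + 1)⁻¹ * (((n + 1 : ℕ) : ℝ) + 1) = 1 := by push_cast; field_simp
        rw [this, one_smul]
      have hmul : taylorRemOp n X * X ^ (n + 1)
          = X ^ (n + 1) + ((n : ℝ) + 1 + 1)⁻¹ • (taylorRemOp (n + 1) X * X ^ (n + 1 + 1)) := by
        rw [taylorRem_step n X, hR, add_mul, one_mul, smul_mul_assoc, smul_mul_assoc, mul_assoc, ← pow_succ']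
      rw [ih, Finset.sum_range_succ _ (n + 1), hmul, smul_add, smul_smul, ← hfac]
      abel

/-- `X` commutes with its remainder `R_{n+1}(X)` (print writes the remainder term of (3.14) as `z^{n̄+1}R_{n̄+1}(z)` for the
matrix `z = ηqe(L^kε)A`; either order). [cite: Balaban1982Higgs1, (3.14) p.614] -/
theorem commute_taylorRemOp (n : ℕ) (X : 𝔸) : Commute X (taylorRemOp n X) := by
  unfold taylorRemOp
  refine Commute.smul_right ?_ _
  have h0 := intervalIntegrable_kernel n X 0 1
  have hL := ((ContinuousLinearMap.mul ℝ 𝔸) X).intervalIntegral_comp_comm h0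
  have hR := ((ContinuousLinearMap.mul ℝ 𝔸).flip X).intervalIntegral_comp_comm h0
  simp only [ContinuousLinearMap.mul_apply', ContinuousLinearMap.flip_apply] at hL hR
  show X * _ = _ * X
  rw [← hL, ← hR]
  congr 1; funext t
  rw [mul_smul_comm, smul_mul_assoc, (commute_exp_smul X t).eq]

/-- **(I.3.14) in print's order**: `exp X = Σ_{m=0}^{n} X^m/m! + (1/(n+1)!)·X^{n+1}·R_{n+1}(X)`
(*"U(A) = exp(ηqe(L^kε)A) = 1 + Σ_{n=1}^{n̄}(ηqe(L^kε)A)ⁿ/n! + (ηqe(L^kε)A)^{n̄+1}/(n̄+1)! R_{n̄+1}(ηqe(L^kε)A)"*).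
[cite: Balaban1982Higgs1, (3.14) p.614] -/
theorem exp_eq_taylor_sum_add' (n : ℕ) (X : 𝔸) :
    exp X = ∑ m ∈ Finset.range (n + 1), ((m.factorial : ℝ)⁻¹) • X ^ m
      + (((n + 1).factorial : ℝ)⁻¹) • (X ^ (n + 1) * taylorRemOp n X) := by
  rw [exp_eq_taylor_sum_add n X, ((commute_taylorRemOp n X).pow_left (n + 1)).eq]

/-! ## §3. `|R_{n̄+1}(·)| ≦ 1` -/

omit [CompleteSpace 𝔸] in
/-- **`‖R_{n+1}(X)‖ ≦ 1` whenever `‖exp(tX)‖ ≦ 1` on `[0, 1]`**: `‖∫₀¹(1−t)ⁿexp(tX)dt‖ ≦ ∫₀¹(1−t)ⁿdt = 1/(n+1)`.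
[cite: Balaban1982Higgs1, p.615 (bound on R_{n̄+1})] -/
theorem norm_taylorRemOp_le_one (n : ℕ) (X : 𝔸) (hX : ∀ t ∈ Set.Icc (0:ℝ) 1, ‖exp (t • X)‖ ≤ 1) :
    ‖taylorRemOp n X‖ ≤ 1 := by
  unfold taylorRemOp
  have hint : ‖∫ t in (0:ℝ)..1, (1 - t) ^ n • exp (t • X)‖ ≤ 1 / (n + 1) := by
    have hbound : IntervalIntegrable (fun t : ℝ => (1 - t) ^ n) volume 0 1 :=
      ((continuous_const.sub continuous_id).pow n).intervalIntegrable 0 1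
    calc ‖∫ t in (0:ℝ)..1, (1 - t) ^ n • exp (t • X)‖
        ≤ ∫ t in (0:ℝ)..1, (1 - t) ^ n := by
          refine norm_integral_le_of_norm_le zero_le_one ?_ hbound
          refine Filter.Eventually.of_forall fun t ht => ?_
          have ht' : 0 ≤ 1 - t := by linarith [ht.2]
          have htI : t ∈ Set.Icc (0:ℝ) 1 := ⟨ht.1.le, ht.2⟩
          calc ‖(1 - t) ^ n • exp (t • X)‖ ≤ ‖(1 - t) ^ n‖ * ‖exp (t • X)‖ := norm_smul_le _ _
            _ ≤ (1 - t) ^ n * 1 := by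
                rw [Real.norm_eq_abs, abs_of_nonneg (pow_nonneg ht' n)]
                exact mul_le_mul_of_nonneg_left (hX t htI) (pow_nonneg ht' n)
            _ = (1 - t) ^ n := mul_one _
      _ = 1 / (n + 1) := by
          have h := intervalIntegral.integral_comp_sub_left (fun x : ℝ => x ^ n) (1 : ℝ) (a := 0) (b := 1)
          simp only [sub_self, sub_zero] at h
          rw [h, integral_pow]
          simp
  have hn : ‖((n : ℝ) + 1)‖ = (n : ℝ) + 1 := by
    rw [Real.norm_eq_abs, abs_of_nonneg (by positivity)]
  calc ‖((n : ℝ) + 1) • ∫ t in (0:ℝ)..1, (1 - t) ^ n • exp (t • X)‖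
      ≤ ‖((n : ℝ) + 1)‖ * ‖∫ t in (0:ℝ)..1, (1 - t) ^ n • exp (t • X)‖ := norm_smul_le _ _
    _ ≤ ((n : ℝ) + 1) * (1 / (n + 1)) := by rw [hn]; exact mul_le_mul_of_nonneg_left hint (by positivity)
    _ = 1 := by field_simp

end Remainder

/-! ## §3′. The charge datum: `|R_{n̄+1}(qA)| ≦ 1` for arbitrary real `A` -/

section ChargeRemainder

variable {N : ℕ} (C : ChargeData N)

/-- **`‖R_{n̄+1}(s·q)‖ ≦ 1` for EVERY real `s`** — the second vertex inequality of [Balaban1983Higgs3] p. 426 (*"in vertices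
we apply the inequalities |q| ≦ 1, |R_{n̄+1}(·)| ≦ 1"*) for the MATRIX-valued remainder of (1.15) / (I.3.14) (p. 414: *"values
in linear operators on R^N satisfying the inequality |R_{n̄+1}(qA)| ≦ 1"*; [Balaban1982Higgs1] p. 615: *"holds for arbitrary real
A"*), since `exp(tsq)` is unitary; in (1.15) `s = e(L^kε)Ã(Γ^{(k)}_{y,x})`.  The scalar `N = 2` twin (`q = i`) is r12's
`B1Sect3Statements.remBound_holds`. [cite: Balaban1983Higgs3, p.426 (vertex bounds after (2.12)), (1.15) p.414]
[cite: Balaban1982Higgs1, p.615 (bound on R_{n̄+1})] -/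
theorem norm_remOp_q_le_one (n : ℕ) (s : ℝ) : ‖taylorRemOp n (s • C.q)‖ ≤ 1 :=
  norm_taylorRemOp_le_one n (s • C.q) fun t _ => by
    rw [smul_smul]
    exact norm_exp_smul_q_le_one C (t * s)

/-- The full tensor of the R-vertex (1.15), `q^{m}R_{n̄+1}(sq)`, has norm `≦ 1` (both vertex inequalities at once).
[cite: Balaban1983Higgs3, p.426 (vertex bounds after (2.12)), (1.15) p.414] -/
theorem norm_qpow_mul_remOp_le_one (m n : ℕ) (s : ℝ) : ‖C.q ^ m * taylorRemOp n (s • C.q)‖ ≤ 1 :=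
  calc ‖C.q ^ m * taylorRemOp n (s • C.q)‖ ≤ ‖C.q ^ m‖ * ‖taylorRemOp n (s • C.q)‖ := norm_mul_le _ _
    _ ≤ 1 * 1 := mul_le_mul (norm_q_pow_le_one C m) (norm_remOp_q_le_one C n s) (norm_nonneg _) zero_le_one
    _ = 1 := one_mul _

/-- (I.3.14) for the transports: `U(A) = exp(qηeA) = Σ_{m=0}^{n̄} (ηeA)^m q^m/m! + (ηeA)^{n̄+1}/(n̄+1)! · q^{n̄+1} R_{n̄+1}(ηeA·q)`
— the expansion whose last term produces the R-vertices (1.9), (1.11), (1.15). [cite: Balaban1982Higgs1, (3.14) p.614]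
[cite: Balaban1983Higgs3, (1.15) p.414] -/
theorem U_eq_taylor_sum_add (n : ℕ) (η A : ℝ) :
    C.U η A = ∑ m ∈ Finset.range (n + 1), ((m.factorial : ℝ)⁻¹) • ((η * C.e * A) • C.q) ^ m
      + (((n + 1).factorial : ℝ)⁻¹) • (((η * C.e * A) • C.q) ^ (n + 1) * taylorRemOp n ((η * C.e * A) • C.q)) :=
  exp_eq_taylor_sum_add' n _

end ChargeRemainder

end

end Literature.MathematicalPhysics.QuantumFieldTheory.Balaban1983to89.B3VertexTensorBounds
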